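import Summits.QuantumFields.BalabanUV.Beta.EriceFlowEnclosureB12AsPrintedPointwiseFadingOrderSharpWitnessEnd

/-!
# Beta / EriceFlowEnclosureB12AsPrintedPointwiseFadingOrderSharpContraction — WHAT (0.31) FORCES POINTWISE, part 7♯, NO CUTOFF-UNIFORM MODULUS WITHOUT ASYMPTOTIC
# FREEDOM.  Inside the sharp box Cγ³ ≤ 2(1 − √θ)² the moduli alone make «g₀ ↦ g_K» strictly increasing on every lattice (`…Sharp.order_preserved_sqrt`), with the LATTICE-WISE
# separation 1∕g_K² − 1∕g′_K² ≥ (√θ)^K·(1∕g_0² − 1∕g′_0²) (`…Sharp.lower_of_ratio`): the inverse map (renormalized ↦ bare, Theorem 2's «g₀ = g₀(ε, g)») is Lipschitz in the chart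
# with a constant (1∕√θ)^K that DEGENERATES with the cutoff.  A K-UNIFORM constant — HADAMARD's third leg uniformly in ε, the shape of prover 1's #62g (2-Lipschitz under the AF
# letter `BetaLowerH b`) and of node U2's `T4TwoRunUniqueness.disc₀_le_of_pins` (regime (iii): summable AF weights) — was recorded by gen 44 as «impossible without AF — not a task»
# (unit HANDOFF gen 44 OPEN (b)).  THIS MODULE MAKES IT A THEOREM with the clamp family of `…SharpWitness`: below the edge its two runs (g′ ≡ 1 and the run started just below 1)
# keep their order AND CONTRACT — in the band every term of the adversarial sum is ≥ 0, so D_{k+1} ≤ (1 − c_k)D_k ≤ (1 − c₋)D_k (`band_upper_step`, `band_contraction`), i.e.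
#                       0 < 1∕g_K² − 1∕g′_K² ≤ (1 − c₋)^K · (1∕g_0² − 1∕g′_0²),        c₋ = C(1−τ)²∕(2+τ) ∈ ]0, 1[,
# whence **`no_uniform_inverse_modulus`**: for every 0 < θ < 1 and every L > 0 there are C ≥ 0, γ > 0 with Cγ³ ≤ 2(1−√θ)² (INSIDE the sharp box), Λ with `FadingMemory C θ Λ`,
# β with `HistLipschitz Λ γ β`, a depth K and two in-box runs of (0.20) with g_0 < g′_0 (so g_K < g′_K) and **L·(1∕g_K² − 1∕g′_K²) < 1∕g_0² − 1∕g′_0²**: no bound |Δbare| ≤ L·|Δrenormalized|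
# with L independent of K follows from the moduli — continuous dependence of the bare coupling on the renormalized one, UNIFORMLY IN THE CUTOFF, genuinely needs the
# asymptotic-freedom weights (prover 1's `BetaLowerH b`, node U2's regime (iii)), exactly as gen 44 recorded
# (β-flow team, prover 2 = lower ∕ positivity side, unit `b2b-balaban-beta-bflow-p2`, gen 45; ROW AP-I × node U2's letters; a TOY FAMILY of ours)

HONEST FRAMING (page 1 of everything the β sub-cell writes): discharging `BetaPertH` makes Bałaban's UV stability UNCONDITIONAL — a
real constructive-QFT result; it is NOT the continuum limit and NOT the Clay problem.  HONEST DEPENDENCY (cell reorg 2026-08-19,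
verbatim): «continuum YM on T⁴ ⇐ BetaPertH ∧ nine spine estimates (0/9 proved); BetaPertH ⇐ (D1) ∧ (D4) ∧ CAP+tail; G-an2-4 gates
asym, D1 and NE2/3/4.»  THIS MODULE DISCHARGES NOTHING: it is elementary real analysis about an EXPLICIT TOY family (ours — NOT Bałaban's β of
[I] = T. Bałaban, Commun. Math. Phys. **109** (1987) [Balaban1987RG1] (1.22) p. 264) and the forward solutions of the recursion (0.20) p. 256 for it; the
moduli it inhabits are node U2's UNPRINTED hypothesis shapes (GAPS G-t4-U2-2; p. 298).  Continuity ∕ uniqueness of «g₀ = g₀(ε, g)» are NOT printed (Theorem 2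
p. 259 is an existence statement, STATED WITHOUT PROOF — custodian's DELTA-I D-21); where they hold they are the consumer's theorems under the consumer's letters.

WHAT THIS FILE PROVES (0 sorry, 0 def): `band_upper_step`, `band_contraction`, `small_constants`, **`clampRun_contracts`**, **`no_uniform_inverse_modulus`**.
NOT CLAIMED: anything about Bałaban's β; that AF fails for it; Theorem 2; `BetaPertH`; continuum; Clay.
-/

namespace Summit.QuantumFields.BalabanUV.Beta.EriceFlowEnclosureB12AsPrintedPointwiseFadingOrderSharpContraction

open Finset
open Literature.MathematicalPhysics.QuantumFieldTheory.Balaban1983to89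
open Literature.MathematicalPhysics.QuantumFieldTheory.Balaban1983to89.FlowStep (HBeta prefixOf Box mem_box RGEqH)
open Literature.MathematicalPhysics.QuantumFieldTheory.Balaban1983to89.T4CouplingMatching (HistLipschitz FadingMemory)
open Summit.QuantumFields.BalabanUV.Beta.EriceFlowEnclosureB12AsPrintedPointwiseFadingOrderSharp (order_preserved_sqrt)
open Summit.QuantumFields.BalabanUV.Beta.EriceFlowEnclosureB12AsPrintedPointwiseFadingOrderSharpWitness
open Summit.QuantumFields.BalabanUV.Beta.EriceFlowEnclosureB12AsPrintedPointwiseFadingOrderSharpWitnessEnd (clampRun)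

noncomputable section

variable {β : HBeta} {C θ τ : ℝ}

/-- **UPPER STEP IN THE BAND.**  Clamp family (letter `hβ`, C ≥ 0, θ ≥ 0); a positive run of (0.20) of length n in the band |1 − a_i| ≤ τ whose discrepancies D_i = 1∕a_i² − 1 against the
constant run are ≥ 0 for i ≤ k (k < n): `D_{k+1} ≤ (1 − C·a_k²∕(1+a_k))·D_k` — every term of the adversarial sum of `band_recursion` is ≥ 0, keep only the age-0 one.
[cite: Balaban1987RG1, (0.20) p.256 with p.298] -/
theorem band_upper_step
    (hβ : ∀ (k : ℕ) (p : Fin (k + 1) → ℝ), β k p = C * ∑ i : Fin (k + 1), θ ^ (k - (i : ℕ)) * max (-τ) (min τ (1 - p i)))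
    (hC : 0 ≤ C) (hθ : 0 ≤ θ)
    {n : ℕ} {a : ℕ → ℝ} (ha : RGEqH n β a) (hpos : ∀ i, i ≤ n → 0 < a i) (hband : ∀ i, i ≤ n → |1 - a i| ≤ τ)
    {k : ℕ} (hk : k < n) (hD : ∀ i, i ≤ k → 0 ≤ 1 / a i ^ 2 - 1) :
    1 / a (k + 1) ^ 2 - 1 ≤ (1 - C * (a k ^ 2 / (1 + a k))) * (1 / a k ^ 2 - 1) := by
  have h := band_recursion hβ ha hpos hband hk
  rw [Finset.sum_range_succ, Nat.sub_self, pow_zero, one_mul] at h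
  have hrest : 0 ≤ ∑ i ∈ range k, θ ^ (k - i) * (C * (a i ^ 2 / (1 + a i))) * (1 / a i ^ 2 - 1) := by
    refine Finset.sum_nonneg fun i hi => ?_
    have hik : i ≤ k := (mem_range.mp hi).le
    have hai := hpos i (hik.trans hk.le)
    exact mul_nonneg (mul_nonneg (pow_nonneg hθ _) (by positivity)) (hD i hik)
  rw [h]
  nlinarith [hrest]

/-- **CONTRACTION IN THE BAND.**  Same letters, with C(1−τ)²∕(2+τ) ≤ 1 and τ ≤ 1: if D_i ≥ 0 for all i ≤ n then `D_m ≤ (1 − C(1−τ)²∕(2+τ))^m · D_0` for every m ≤ n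
(`band_upper_step` + `coeff_lower`, induction). [cite: Balaban1987RG1, (0.20) p.256 with p.298] -/
theorem band_contraction
    (hβ : ∀ (k : ℕ) (p : Fin (k + 1) → ℝ), β k p = C * ∑ i : Fin (k + 1), θ ^ (k - (i : ℕ)) * max (-τ) (min τ (1 - p i)))
    (hC : 0 ≤ C) (hθ : 0 ≤ θ) (hτ1 : τ ≤ 1) (hc1 : C * ((1 - τ) ^ 2 / (2 + τ)) ≤ 1)
    {n : ℕ} {a : ℕ → ℝ} (ha : RGEqH n β a) (hpos : ∀ i, i ≤ n → 0 < a i) (hband : ∀ i, i ≤ n → |1 - a i| ≤ τ)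
    (hD : ∀ i, i ≤ n → 0 ≤ 1 / a i ^ 2 - 1) :
    ∀ m, m ≤ n → 1 / a m ^ 2 - 1 ≤ (1 - C * ((1 - τ) ^ 2 / (2 + τ))) ^ m * (1 / a 0 ^ 2 - 1) := by
  intro m
  induction m with
  | zero => intro _; simp
  | succ m ih =>
    intro hm
    have hmn : m < n := Nat.lt_of_succ_le hm
    have hprev := ih hmn.le
    have hstep := band_upper_step hβ hC hθ ha hpos hband hmn (fun i hi => hD i (hi.trans hmn.le))
    have hcl : C * ((1 - τ) ^ 2 / (2 + τ)) ≤ C * (a m ^ 2 / (1 + a m)) :=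
      mul_le_mul_of_nonneg_left (coeff_lower hτ1 (hband m hmn.le)) hC
    have hq0 : 0 ≤ 1 - C * ((1 - τ) ^ 2 / (2 + τ)) := by linarith
    calc 1 / a (m + 1) ^ 2 - 1 ≤ (1 - C * (a m ^ 2 / (1 + a m))) * (1 / a m ^ 2 - 1) := hstep
      _ ≤ (1 - C * ((1 - τ) ^ 2 / (2 + τ))) * (1 / a m ^ 2 - 1) :=
          mul_le_mul_of_nonneg_right (by linarith) (hD m hmn.le)
      _ ≤ (1 - C * ((1 - τ) ^ 2 / (2 + τ))) * ((1 - C * ((1 - τ) ^ 2 / (2 + τ))) ^ m * (1 / a 0 ^ 2 - 1)) :=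
          mul_le_mul_of_nonneg_left hprev hq0
      _ = (1 - C * ((1 - τ) ^ 2 / (2 + τ))) ^ (m + 1) * (1 / a 0 ^ 2 - 1) := by rw [pow_succ]; ring

/-- **SMALL CONSTANTS INSIDE THE SHARP BOX.**  For θ < 1: C := (1−√θ)²∕2 and τ := ¼ have C > 0, C(1+τ)³ ≤ 2(1−√θ)² (the box γ = 5∕4 is inside the sharp box) and the band coefficient
c₋ = C(1−τ)²∕(2+τ) = C∕4 ∈ ]0, 1[. [folklore] -/
theorem small_constants {θ : ℝ} (hθ1 : θ < 1) (hθ0 : 0 ≤ θ) :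
    0 < (1 - Real.sqrt θ) ^ 2 / 2 ∧
      (1 - Real.sqrt θ) ^ 2 / 2 * (1 + 1 / 4) ^ 3 ≤ 2 * (1 - Real.sqrt θ) ^ 2 ∧
      0 < (1 - Real.sqrt θ) ^ 2 / 2 * ((1 - 1 / 4) ^ 2 / (2 + 1 / 4)) ∧
      (1 - Real.sqrt θ) ^ 2 / 2 * ((1 - 1 / 4) ^ 2 / (2 + 1 / 4)) < 1 := by
  have hs1 : Real.sqrt θ < 1 := by
    rw [← Real.sqrt_one]; exact Real.sqrt_lt_sqrt hθ0 hθ1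
  have hs0 : 0 ≤ Real.sqrt θ := Real.sqrt_nonneg θ
  have he0 : 0 < (1 - Real.sqrt θ) ^ 2 := by
    have : 0 < 1 - Real.sqrt θ := by linarith
    positivity
  have he1 : (1 - Real.sqrt θ) ^ 2 ≤ 1 := by nlinarith
  refine ⟨by positivity, by nlinarith, by positivity, ?_⟩
  norm_num
  nlinarith

/-- **THE CLAMP RUN KEEPS ITS ORDER AND CONTRACTS.**  Clamp family with 0 < θ < 1, C ≥ 0, 0 < τ ≤ 1, box γ = 1 + τ INSIDE the sharp box (C(1+τ)³ ≤ 2(1−√θ)²), band coefficient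
C(1−τ)²∕(2+τ) ≤ 1; the run g of `clampRun` (depth N, start 1∕√(1+δ₀), M^Nδ₀ ≤ τ∕2) against g′ ≡ 1: for every j ≤ N, `0 < 1∕g_j² − 1 ≤ (1 − C(1−τ)²∕(2+τ))^j · δ₀` — positivity is
`…Sharp.order_preserved_sqrt` (g_j < 1), the decay is `band_contraction`. [cite: Balaban1987RG1, (0.20) p.256 with p.298] -/
theorem clampRun_contracts
    (hβ : ∀ (k : ℕ) (p : Fin (k + 1) → ℝ), β k p = C * ∑ i : Fin (k + 1), θ ^ (k - (i : ℕ)) * max (-τ) (min τ (1 - p i)))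
    (hC : 0 ≤ C) (hθ0 : 0 < θ) (hθ1 : θ < 1) (hτ0 : 0 < τ) (hτ1 : τ ≤ 1)
    (hbox : C * (1 + τ) ^ 3 ≤ 2 * (1 - Real.sqrt θ) ^ 2) (hc1 : C * ((1 - τ) ^ 2 / (2 + τ)) ≤ 1)
    {M δ₀ : ℝ} (hM : M = 1 + 2 * C / (1 - θ)) (hδ : 0 < δ₀) {N : ℕ} (hN : M ^ N * δ₀ ≤ τ / 2)
    {tbl : ℕ → ℕ → ℝ}
    (hcs : ∀ k i, tbl (k + 1) i =
      if i ≤ k then tbl k i else 1 / Real.sqrt (1 / (tbl k k) ^ 2 - β k (fun j : Fin (k + 1) => tbl k j)))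
    (h0 : tbl 0 0 = 1 / Real.sqrt (1 + δ₀)) :
    RGEqH N β (fun k => tbl k k) ∧ (∀ i, i ≤ N → 0 < tbl i i ∧ tbl i i ≤ 1 + τ) ∧
      ∀ j, j ≤ N → 0 < 1 / (tbl j j) ^ 2 - 1 ∧
        1 / (tbl j j) ^ 2 - 1 ≤ (1 - C * ((1 - τ) ^ 2 / (2 + τ))) ^ j * δ₀ := by
  obtain ⟨hin, hrg⟩ := clampRun hβ hC hθ0.le hθ1 hτ1 hM hδ hN hcs h0
  have h1θ : 0 < 1 - θ := by linarith
  have hM1 : 1 ≤ M := by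
    have : 0 ≤ 2 * C / (1 - θ) := div_nonneg (by linarith) h1θ.le
    rw [hM]; linarith
  have hpos : ∀ i, i ≤ N → 0 < tbl i i := fun i hi => (hin i hi).1
  have hband : ∀ i, i ≤ N → |1 - tbl i i| ≤ τ := fun i hi =>
    (abs_one_sub_le_of_inv_sq (hpos i hi) (by linarith)
      (((hin i hi).2.trans (mul_le_mul_of_nonneg_right (pow_le_pow_right₀ hM1 hi) hδ.le)).trans hN)).trans
      (by linarith)
  have hbx : ∀ i, i ≤ N → 0 < tbl i i ∧ tbl i i ≤ 1 + τ := fun i hi =>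
    ⟨hpos i hi, by linarith [(abs_le.mp (hband i hi)).1]⟩
  obtain ⟨hs0, hs1, hsD⟩ := start_facts hδ
  -- order against the constant run inside the sharp box: g_j < 1, i.e. D_j > 0
  have hlt : ∀ j, j ≤ N → tbl j j < 1 := by
    have h00 : tbl 0 0 < (fun _ : ℕ => (1 : ℝ)) 0 := by show tbl 0 0 < 1; rw [h0]; exact hs1
    exact order_preserved_sqrt (β := β) hθ0 hθ1 hC hrg (rgEqH_const hβ hτ0.le N) hbx
      (fun i _ => ⟨one_pos, by linarith⟩) (histLipschitz_clamp hβ hC hθ0.le _) (fadingMemory_clamp hC hθ0.le)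
      hbox h00
  have hDpos : ∀ j, j ≤ N → 0 < 1 / (tbl j j) ^ 2 - 1 := by
    intro j hj
    have hp := hpos j hj
    have h1 : (tbl j j) ^ 2 < 1 := by nlinarith [hlt j hj]
    rw [sub_pos, lt_div_iff₀ (by positivity)]
    linarith
  have hcontr := band_contraction hβ hC hθ0.le hτ1 hc1 hrg hpos hband (fun i hi => (hDpos i hi).le)
  refine ⟨hrg, hbx, fun j hj => ⟨hDpos j hj, ?_⟩⟩
  have h := hcontr j hj
  rwa [h0, hsD] at h

/-- **NO CUTOFF-UNIFORM INVERSE MODULUS FROM THE MODULI ALONE.**  For every 0 < θ < 1 and every L > 0 there are C ≥ 0, γ > 0 with **Cγ³ ≤ 2(1 − √θ)²** (inside the sharp box,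
so order and uniqueness hold on every lattice), moduli Λ with `FadingMemory C θ Λ`, a history-dependent β with `HistLipschitz Λ γ β` (the clamp family), a depth K and two runs g, g′ of
(0.20) of length K inside ]0, γ] with g_0 < g′_0 and **L·(1∕g_K² − 1∕g′_K²) < 1∕g_0² − 1∕g′_0²** (both sides positive).  Hence NO estimate |1∕g_0² − 1∕g′_0²| ≤ L·|1∕g_K² − 1∕g′_K²| with L
independent of K — continuous dependence of the bare on the renormalized coupling UNIFORMLY IN THE CUTOFF, prover 1's #62g ∕ node U2's `disc₀_le_of_pins` shape — follows from fading memory;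
their asymptotic-freedom weights are load-bearing (gen 44 OPEN (b), now a theorem).  (`small_constants`, `clampRun_contracts` at a depth K with (1 − c₋)^K < 1∕L.)
[cite: Balaban1987RG1, (0.20) p.256 with p.298 and Thm 2 p.259 («g₀ = g₀(ε, g)»)] -/
theorem no_uniform_inverse_modulus {θ L : ℝ} (hθ0 : 0 < θ) (hθ1 : θ < 1) (hL : 0 < L) :
    ∃ (C γ : ℝ) (Λ : ℕ → ℕ → ℝ) (β : HBeta) (K : ℕ) (g g' : ℕ → ℝ),
      0 ≤ C ∧ 0 < γ ∧ C * γ ^ 3 ≤ 2 * (1 - Real.sqrt θ) ^ 2 ∧ FadingMemory C θ Λ ∧ HistLipschitz Λ γ β ∧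
      RGEqH K β g ∧ RGEqH K β g' ∧ (∀ i, i ≤ K → 0 < g i ∧ g i ≤ γ) ∧ (∀ i, i ≤ K → 0 < g' i ∧ g' i ≤ γ) ∧
      g 0 < g' 0 ∧ 0 < 1 / (g K) ^ 2 - 1 / (g' K) ^ 2 ∧
      L * (1 / (g K) ^ 2 - 1 / (g' K) ^ 2) < 1 / (g 0) ^ 2 - 1 / (g' 0) ^ 2 := by
  obtain ⟨hC0, hbox, hcm0, hcm1⟩ := small_constants hθ1 hθ0.le
  set C : ℝ := (1 - Real.sqrt θ) ^ 2 / 2 with hC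
  set τ : ℝ := 1 / 4 with hτ
  set q : ℝ := 1 - C * ((1 - τ) ^ 2 / (2 + τ)) with hq
  have hq0 : 0 ≤ q := by rw [hq]; linarith
  have hq1 : q < 1 := by rw [hq]; linarith
  -- a depth with q^K < 1/L
  obtain ⟨K, hK⟩ := exists_pow_lt_of_lt_one (one_div_pos.mpr hL) hq1
  -- the family
  let βt : HBeta := fun k p => C * ∑ i : Fin (k + 1), θ ^ (k - (i : ℕ)) * max (-τ) (min τ (1 - p i))
  have hβ : ∀ (k : ℕ) (p : Fin (k + 1) → ℝ),
      βt k p = C * ∑ i : Fin (k + 1), θ ^ (k - (i : ℕ)) * max (-τ) (min τ (1 - p i)) := fun _ _ => rfl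
  have h1θ : 0 < 1 - θ := by linarith
  set M : ℝ := 1 + 2 * C / (1 - θ) with hM
  have hMpos : 0 < M := by
    have : 0 ≤ 2 * C / (1 - θ) := div_nonneg (by linarith) h1θ.le
    rw [hM]; linarith
  have hMN : 0 < M ^ K := pow_pos hMpos _
  set δ₀ : ℝ := τ / (2 * M ^ K) with hδ₀
  have hδ : 0 < δ₀ := by rw [hδ₀]; positivity
  have hN : M ^ K * δ₀ ≤ τ / 2 := by
    rw [hδ₀, mul_div_assoc', mul_comm (M ^ K) τ, mul_div_mul_right _ _ hMN.ne']
  let tbl : ℕ → ℕ → ℝ := fun k => Nat.rec (motive := fun _ => ℕ → ℝ) (fun _ => 1 / Real.sqrt (1 + δ₀))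
      (fun k t i => if i ≤ k then t i else 1 / Real.sqrt (1 / (t k) ^ 2 - βt k (fun j : Fin (k + 1) => t j))) k
  have hcs : ∀ (k i : ℕ), tbl (k + 1) i =
      if i ≤ k then tbl k i else 1 / Real.sqrt (1 / (tbl k k) ^ 2 - βt k (fun j : Fin (k + 1) => tbl k j)) :=
    fun _ _ => rfl
  have h0 : tbl 0 0 = 1 / Real.sqrt (1 + δ₀) := rfl
  obtain ⟨hrg, hbx, hD⟩ := clampRun_contracts hβ hC0.le hθ0 hθ1 (by norm_num) (by norm_num) hbox hcm1.le hM hδ hN hcs h0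
  obtain ⟨hs0, hs1, hsD⟩ := start_facts hδ
  have hD0 : 1 / (tbl 0 0) ^ 2 - 1 = δ₀ := by rw [h0, hsD]
  refine ⟨C, 1 + τ, fun k i => C * θ ^ (k - i), βt, K, fun k => tbl k k, fun _ => 1, hC0.le, by norm_num, hbox,
    fadingMemory_clamp hC0.le hθ0.le, histLipschitz_clamp hβ hC0.le hθ0.le _, hrg, rgEqH_const hβ (by norm_num) _,
    hbx, fun i _ => ⟨one_pos, by norm_num⟩, ?_, ?_, ?_⟩
  · show tbl 0 0 < 1
    rw [h0]; exact hs1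
  · show 0 < 1 / (tbl K K) ^ 2 - 1 / (1 : ℝ) ^ 2
    rw [one_pow, div_one]; exact (hD K le_rfl).1
  · show L * (1 / (tbl K K) ^ 2 - 1 / (1 : ℝ) ^ 2) < 1 / (tbl 0 0) ^ 2 - 1 / (1 : ℝ) ^ 2
    rw [one_pow, div_one, hD0]
    have h2 := (hD K le_rfl).2
    have hqK : L * q ^ K < 1 := by
      have := mul_lt_mul_of_pos_left hK hL
      rwa [mul_one_div_cancel hL.ne'] at this
    calc L * (1 / (tbl K K) ^ 2 - 1) ≤ L * (q ^ K * δ₀) := mul_le_mul_of_nonneg_left h2 hL.le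
      _ = (L * q ^ K) * δ₀ := by ring
      _ < 1 * δ₀ := mul_lt_mul_of_pos_right hqK hδ
      _ = δ₀ := one_mul _

end

end Summit.QuantumFields.BalabanUV.Beta.EriceFlowEnclosureB12AsPrintedPointwiseFadingOrderSharpContraction
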